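import Summits.ResolutionOfSingularities.ResolutionOfSingularities.Theorems.DescentDescentPerfectToAllFinitePBasis
import Mathlib.FieldTheory.KummerPolynomial

/-!
# `DescentPerfectToAll` (stmt-ResolutionOfSingularities-0549): the chain criterion for `p`-independence

Route `ResolutionOfSingularities/Descent`, crux `DescentPerfectToAll`. Helper (OURS; not a statement of any
manuscript). `DescentDescentPerfectToAllFinitePBasis.lean` proves the crux's conclusion (given `PerfectRes p`)
over every ground field `k` algebraic over `𝔽_p(t₁, …, tₙ)` with `t` `p`-INDEPENDENT in `k`, where
`p`-independence is taken in Teichmüller's form «the reduced monomials `t^α`, `α : ι → Fin p`, are `k^p`-free».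
This file supplies the usual inductive test for that hypothesis and the resulting user-facing form of the
layer:

* `eq_zero_of_sum_pow_mul_eq_zero` — if `K ≤ k` is a subfield containing all `p`-th powers and `t ∉ K`, then
  `1, t, …, t^{p-1}` are `K`-linearly independent (`X^p − t^p` is irreducible over `K`).
* `pIndependent_of_chain` — **CHAIN CRITERION**: if `t : Fin n → k` satisfies
  `t j ∉ k^p(t i : i < j)` for every `j` (as subfields: `closure (range (·^p) ∪ t '' {i | i < j})`), then
  `t` is `p`-independent in `k` (induction on `n`, peeling off the last variable).
* `hasResolution_of_perfectRes_of_pChain` / `descentPerfectToAll_pChain` — the finite-`p`-basis layer of the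
  crux with the chain criterion as hypothesis: `PerfectRes p`, `t j ∉ k^p(t_{<j})` for all `j`, `k` algebraic
  over `closure (range t)` ⇒ every reduced separated `k`-scheme of finite type has a resolution.
-/

noncomputable section

set_option linter.dupNamespace false -- mandated namespace of this single-conjunct summit

open CategoryTheory CategoryTheory.Limits AlgebraicGeometry Polynomial
open Literature.AlgebraicGeometry.Resolution

namespace Summit.ResolutionOfSingularities.ResolutionOfSingularities.Theorems

section Chain

variable {p : ℕ} [Fact p.Prime] {k : Type} [Field k] [CharP k p]

/-- If a subfield `K ≤ k` contains every `p`-th power and `t ∉ K`, then a relation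
`∑_{j<p} t^j c_j = 0` with `c_j ∈ K` is trivial: `X^p − t^p` is irreducible over `K` (a `p`-th root of
`t^p` in `K` would be `t` itself, Frobenius being injective), so it is the minimal polynomial of `t` and
`1, t, …, t^{p-1}` are `K`-linearly independent. [folklore] -/
theorem eq_zero_of_sum_pow_mul_eq_zero (K : Subfield k) (hK : ∀ x : k, x ^ p ∈ K) {t : k} (ht : t ∉ K)
    (c : Fin p → k) (hc : ∀ j, c j ∈ K) (h : ∑ j : Fin p, t ^ (j : ℕ) * c j = 0) :
    ∀ j, c j = 0 := by
  have hp : p.Prime := Fact.out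
  let a : K := ⟨t ^ p, hK t⟩
  have hirr : Irreducible (X ^ p - C a : K[X]) := by
    refine X_pow_sub_C_irreducible_of_prime hp fun b hb => ht ?_
    have h1 : ((b : k)) ^ p = t ^ p := by
      have := congrArg Subtype.val hb
      simpa using this
    have h2 : (b : k) = t := frobenius_inj k p (by rw [frobenius_def, frobenius_def, h1])
    rw [← h2]
    exact b.2
  have hmonic : (X ^ p - C a : K[X]).Monic := monic_X_pow_sub_C a hp.ne_zero
  have haeval : aeval t (X ^ p - C a : K[X]) = 0 := by
    rw [map_sub, aeval_X_pow, aeval_C]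
    exact sub_self _
  have hmin : minpoly K t = X ^ p - C a := (minpoly.eq_of_irreducible_of_monic hirr haeval hmonic).symm
  have hdeg : (minpoly K t).natDegree = p := by rw [hmin, natDegree_X_pow_sub_C]
  have hli := linearIndependent_pow (K := K) t
  rw [hdeg] at hli
  have hsum : ∑ j : Fin p, (⟨c j, hc j⟩ : K) • t ^ (j : ℕ) = 0 := by
    rw [← h]
    refine Finset.sum_congr rfl fun j _ => ?_
    rw [Algebra.smul_def, mul_comm]
    rfl
  intro j
  have h0 := Fintype.linearIndependent_iff.mp hli _ hsum j
  exact congrArg Subtype.val h0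

/-- **Chain criterion for `p`-independence.** Let `t : Fin n → k`. If for every `j` the element `t j` does
not lie in the subfield `k^p(t i : i < j)` generated by the `p`-th powers of `k` and the earlier `t i`, then
`t` is `p`-independent in `k`: the reduced monomials `∏ᵢ (t i)^{αᵢ}`, `α : Fin n → Fin p`, admit no
nontrivial relation `∑_α t^α e_α^p = 0`. (Induction on `n`: group the relation by the power of the last
variable; the coefficients lie in `k^p(t₀, …, t_{n-2})`, so vanish by `eq_zero_of_sum_pow_mul_eq_zero`; then
apply the induction hypothesis to each of them.) [folklore] -/
theorem pIndependent_of_chain : ∀ {n : ℕ} (t : Fin n → k),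
    (∀ j : Fin n, t j ∉ Subfield.closure
      (Set.range (fun x : k => x ^ p) ∪ t '' {i : Fin n | i < j})) →
    ∀ e : (Fin n → Fin p) → k, ∑ α, (∏ i, t i ^ (α i : ℕ)) * e α ^ p = 0 → ∀ α, e α = 0 := by
  have hp : p.Prime := Fact.out
  intro n
  induction n with
  | zero =>
    intro t _ e he α
    -- a single reduced monomial, equal to `1`
    have hα : α = fun i => Fin.elim0 i := funext fun i => Fin.elim0 i
    have huniv : (Finset.univ : Finset (Fin 0 → Fin p)) = {fun i => Fin.elim0 i} :=
      Finset.eq_singleton_iff_unique_mem.mpr ⟨Finset.mem_univ _, fun β _ => funext fun i => Fin.elim0 i⟩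
    rw [huniv, Finset.sum_singleton, Finset.univ_eq_empty, Finset.prod_empty, one_mul] at he
    rw [hα]
    exact eq_zero_of_pow_eq_zero he
  | succ n ih =>
    intro t ht e he
    -- the earlier variables and the subfield `K = k^p(t₀, …, t_{n-1})`
    set t' : Fin n → k := fun i => t (Fin.castSucc i) with ht'
    set K : Subfield k := Subfield.closure (Set.range (fun x : k => x ^ p) ∪ Set.range t') with hKdef
    have hK : ∀ x : k, x ^ p ∈ K := fun x => Subfield.subset_closure (Or.inl ⟨x, rfl⟩)
    have ht'K : ∀ i, t' i ∈ K := fun i => Subfield.subset_closure (Or.inr ⟨i, rfl⟩)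
    -- `t (last n) ∉ K`
    have hlast : t (Fin.last n) ∉ K := by
      intro hmem
      refine ht (Fin.last n) (Subfield.closure_mono ?_ hmem)
      refine Set.union_subset_union_right _ ?_
      rintro _ ⟨i, rfl⟩
      exact ⟨Fin.castSucc i, Fin.castSucc_lt_last i, rfl⟩
    -- the chain hypothesis for `t'`
    have ht'chain : ∀ j : Fin n, t' j ∉ Subfield.closure
        (Set.range (fun x : k => x ^ p) ∪ t' '' {i : Fin n | i < j}) := by
      intro j hmem
      refine ht (Fin.castSucc j) (Subfield.closure_mono ?_ hmem)
      refine Set.union_subset_union_right _ ?_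
      rintro _ ⟨i, hi, rfl⟩
      exact ⟨Fin.castSucc i, Fin.castSucc_lt_castSucc_iff.mpr hi, rfl⟩
    -- group the relation by the exponent of the last variable
    let c : Fin p → k := fun j => ∑ α' : Fin n → Fin p,
      (∏ i, t' i ^ (α' i : ℕ)) * e (Fin.snoc α' j) ^ p
    have hcK : ∀ j, c j ∈ K := fun j =>
      sum_mem fun α' _ => mul_mem (prod_mem fun i _ => pow_mem (ht'K i) _) (hK _)
    have hsum : ∑ j : Fin p, t (Fin.last n) ^ (j : ℕ) * c j = 0 := by
      rw [← he, ← (Fin.snocEquiv fun _ => Fin p).sum_comp, Fintype.sum_prod_type]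
      refine Finset.sum_congr rfl fun j _ => ?_
      simp only [c, Finset.mul_sum]
      refine Finset.sum_congr rfl fun α' _ => ?_
      have hsnoc : (Fin.snocEquiv fun _ => Fin p) (j, α') = Fin.snoc α' j := rfl
      rw [hsnoc, Fin.prod_univ_castSucc]
      simp only [Fin.snoc_castSucc, Fin.snoc_last, t']
      ring
    have hc0 := eq_zero_of_sum_pow_mul_eq_zero K hK hlast c hcK hsum
    -- the induction hypothesis kills each coefficient family
    have he0 : ∀ (j : Fin p) (α' : Fin n → Fin p), e (Fin.snoc α' j) = 0 := fun j =>
      ih t' ht'chain (fun α' => e (Fin.snoc α' j)) (hc0 j)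
    intro α
    rw [← Fin.snoc_init_self α]
    exact he0 _ _

end Chain

/-! ## The finite-`p`-basis layer with the chain criterion -/

/-- **Resolution over perfect fields ⇒ resolution over every ground field algebraic over `𝔽_p(t₀, …, t_{n-1})`
with `t j ∉ k^p(t i : i < j)` for all `j`** (chain form of `p`-independence), for reduced separated schemes
of finite type of any dimension (`pIndependent_of_chain` + `hasResolution_of_perfectRes_of_pIndependent`).
[folklore] -/
theorem hasResolution_of_perfectRes_of_pChain (p : ℕ) [Fact p.Prime]
    (H : ∀ (κ : Type) [Field κ] [CharP κ p] [PerfectField κ] (Z : Scheme.{0}) (h : Z ⟶ Spec (.of κ)),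
      IsSeparated h → LocallyOfFiniteType h → QuasiCompact h → IsReduced Z → Scheme.HasResolution Z)
    (k : Type) [Field k] [CharP k p] {n : ℕ} (t : Fin n → k)
    (ht : ∀ j : Fin n, t j ∉ Subfield.closure
      (Set.range (fun x : k => x ^ p) ∪ t '' {i : Fin n | i < j}))
    [Algebra.IsAlgebraic (Subfield.closure (Set.range t)) k]
    (X : Scheme.{0}) (f : X ⟶ Spec (.of k)) [IsSeparated f] [LocallyOfFiniteType f] [QuasiCompact f]
    [IsReduced X] : Scheme.HasResolution X :=
  hasResolution_of_perfectRes_of_pIndependent p H k t (pIndependent_of_chain t ht) X f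

/-- **The finite-`p`-basis layer of the crux `DescentPerfectToAll` in chain form, proved** (binder shape of
stmt-0549 with the hypotheses "`t : Fin n → k` with `t j ∉ k^p(t_{<j})` for all `j`" and "`k` algebraic over
`closure (range t)`" inserted). [folklore] -/
theorem descentPerfectToAll_pChain :
    ∀ p : ℕ, p.Prime → (∀ (k : Type) [Field k] [CharP k p] [PerfectField k] (X : Scheme.{0})
      (f : X ⟶ Spec (.of k)), IsSeparated f → LocallyOfFiniteType f → QuasiCompact f →
        IsReduced X → Scheme.HasResolution X) →
    ∀ (k : Type) [Field k] [CharP k p] (n : ℕ) (t : Fin n → k),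
      (∀ j : Fin n, t j ∉ Subfield.closure
        (Set.range (fun x : k => x ^ p) ∪ t '' {i : Fin n | i < j})) →
      Algebra.IsAlgebraic (Subfield.closure (Set.range t)) k →
      ∀ (X : Scheme.{0}) (f : X ⟶ Spec (.of k)),
        IsSeparated f → LocallyOfFiniteType f → QuasiCompact f → IsReduced X →
          Scheme.HasResolution X := by
  intro p hp H k _ _ n t ht halg X f _ _ _ _
  haveI : Fact p.Prime := ⟨hp⟩
  haveI := halg
  exact hasResolution_of_perfectRes_of_pChain p (fun κ _ _ _ Z h a b c d => H κ Z h a b c d) k t ht X f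

end Summit.ResolutionOfSingularities.ResolutionOfSingularities.Theorems

end
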